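import Literature.Probability.Percolation.RingArcs
import HarnessLib

/-!
# Feet of ring sites: the radial adjacency `∂Λ_k → ∂Λ_{k-1}` as a map of periodic indices

Topic `Literature/Probability/Percolation`; family `crit-perc`. Lattice-geometric bookkeeping on the
hexagonal rings `∂Λ_k = {|·|_𝕋 = k}` of the triangular lattice in the periodic enumeration
`rp k i` of `RingArcs.lean` (anticlockwise, period `6k`), prepared for the painted-core gadget of
the separation-free proof of the five-arm upper bound (`FiveArmCoreGadget.lean`; P. Nolin,
EJP 13 (2008), Thm. 24, five-arm item; W. Werner, PCMI 2009, First exercise sheet,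
"Five-arm exponent") — where connectors inside the core `Λ_m` run along the rings `∂Λ_m`,
`∂Λ_{m-1}`, `∂Λ_{m-2}` and change ring at FEET:

* `footIdx k j = j - ⌊j/k⌋` — **the index on `∂Λ_{k-1}` of the upper foot of the site of index
  `j` on `∂Λ_k`**: `rp k j ∼ rp (k-1) (footIdx k j)` (`rp_adj_rp_footIdx`) and
  `rp k j ∼ rp (k-1) (footIdx k (j-1))` (`rp_adj_rp_footIdx_pred`; the lower foot, equal to the
  upper one exactly at the corners), from the rim–ring adjacency of `RingArcs.lean`;
* the arithmetic of `footIdx`: monotone, steps by `0` or `1` (`footIdx_succ_le`), stalls exactly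
  at the corners (`footIdx_succ_eq_iff`: `footIdx k (j+1) = footIdx k j ↔ k ∣ j + 1`), two stalls
  are a side apart (`footIdx_add_le_of_stall`), `d ≤ k` steps advance by at least `d - 1`
  (`footIdx_add_ge`), and one turn advances by one turn (`footIdx_add_period`).

Everything is elementary; no events, no named facts.

## References

* P. Nolin, Near-critical percolation in two dimensions, *Electron. J. Probab.* 13 (2008), §4.1
  and Thm. 24 (arXiv 0711.4948) [Nolin2008].
* W. Werner, *Lectures on two-dimensional critical percolation*, IAS/Park City Math. Ser. 16 (2009),
  First exercise sheet, "Five-arm exponent" (arXiv 0710.0856) [WernerPCMI2009].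

## Mathlib / tree

Tree: `rp`, `rp_of_lt`, `ringPt_six_mul`, `rp_add_mul_period`, `ringPt_adj_ringPt_pred_hi`,
`ringPt_adj_ringPt_pred_lo` (`RingArcs.lean`). Mathlib: `Nat.div_add_mod`, `Nat.add_mul_div_right`,
`Nat.succ_div`, `Nat.div_le_div_right`.
-/

namespace Literature.Probability.Percolation

open LatticeModels

/-! ### The foot index -/

/-- **The index on the ring `∂Λ_{k-1}` of the upper foot of the site of index `j` on `∂Λ_k`**:
`j - ⌊j/k⌋` (on the side `c` at position `t`, `j = c k + t`, this is `c (k-1) + t`). [folklore] -/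
def footIdx (k j : ℕ) : ℕ := j - j / k


/-- `footIdx` is monotone. [folklore] -/
theorem footIdx_mono (k : ℕ) {j j' : ℕ} (h : j ≤ j') : footIdx k j ≤ footIdx k j' := by
  unfold footIdx
  rcases Nat.eq_zero_or_pos k with rfl | hk
  · simpa using h
  obtain ⟨d, rfl⟩ := Nat.exists_eq_add_of_le h
  have h1 : (j + d) / k ≤ j / k + d := by
    calc (j + d) / k ≤ (j + d * k) / k := Nat.div_le_div_right (by nlinarith)
      _ = j / k + d := Nat.add_mul_div_right j d hk
  have h2 := Nat.div_le_self j k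
  have h3 := Nat.div_le_self (j + d) k
  omega

/-- One step advances the foot index by at most one. [folklore] -/
theorem footIdx_succ_le (k j : ℕ) : footIdx k (j + 1) ≤ footIdx k j + 1 := by
  unfold footIdx
  have h1 : j / k ≤ (j + 1) / k := Nat.div_le_div_right (Nat.le_succ j)
  have h2 := Nat.div_le_self j k
  omega

/-- `d` steps advance the foot index by at most `d`. [folklore] -/
theorem footIdx_add_le (k j d : ℕ) : footIdx k (j + d) ≤ footIdx k j + d := by
  induction d with
  | zero => simp
  | succ d ih => exact (footIdx_succ_le k (j + d)).trans (by omega)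

/-- **`d ≤ k` steps advance the foot index by at least `d - 1`** (at most one corner is passed). [folklore] -/
theorem footIdx_add_ge {k j d : ℕ} (hk : 1 ≤ k) (hd : d ≤ k) : footIdx k j + d ≤ footIdx k (j + d) + 1 := by
  unfold footIdx
  have h1 : (j + d) / k ≤ j / k + 1 := by
    calc (j + d) / k ≤ (j + 1 * k) / k := Nat.div_le_div_right (by omega)
      _ = j / k + 1 := Nat.add_mul_div_right j 1 (by omega)
  have h2 := Nat.div_le_self j k
  have h3 : (j + d) / k ≤ j + d := Nat.div_le_self _ _
  omega

/-- **The foot index stalls exactly at the corners**: `footIdx k (j+1) = footIdx k j ↔ k ∣ j + 1`. [folklore] -/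
theorem footIdx_succ_eq_iff {k j : ℕ} : footIdx k (j + 1) = footIdx k j ↔ k ∣ j + 1 := by
  unfold footIdx
  have hsd := @Nat.succ_div j k
  have h2 := Nat.div_le_self j k
  have h3 : j / k < j + 1 := by omega
  by_cases hdvd : k ∣ j + 1
  · simp only [hdvd, if_true] at hsd
    constructor
    · intro; exact hdvd
    · intro; omega
  · simp only [hdvd, if_false, add_zero] at hsd
    constructor
    · intro h; omega
    · intro h; exact absurd h hdvd

/-- Off the corners the foot index advances by one. [folklore] -/
theorem footIdx_succ_eq_of_not_dvd {k j : ℕ} (h : ¬ k ∣ j + 1) : footIdx k (j + 1) = footIdx k j + 1 := by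
  have h1 := footIdx_succ_le k j
  have h2 := footIdx_mono k (Nat.le_add_right j 1)
  have h3 : footIdx k (j + 1) ≠ footIdx k j := fun e => h (footIdx_succ_eq_iff.1 e)
  omega

/-- **Two stalls are a side apart.** [folklore] -/
theorem footIdx_add_le_of_stall {k j j' : ℕ} (hj : footIdx k (j + 1) = footIdx k j)
    (hj' : footIdx k (j' + 1) = footIdx k j') (hlt : j < j') : j + k ≤ j' := by
  rw [footIdx_succ_eq_iff] at hj hj'
  obtain ⟨a, ha⟩ := hj
  obtain ⟨b, hb⟩ := hj'
  have hab : a < b := by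
    by_contra h; push Not at h
    have := Nat.mul_le_mul_left k h; omega
  have : k * (a + 1) ≤ k * b := Nat.mul_le_mul_left k hab
  rw [Nat.mul_add, Nat.mul_one] at this
  omega

/-- **One turn advances the foot index by one turn of the inner ring.** [folklore] -/
theorem footIdx_add_period {k : ℕ} (hk : 1 ≤ k) (j : ℕ) : footIdx k (j + 6 * k) = footIdx k j + 6 * (k - 1) := by
  unfold footIdx
  have h1 : (j + 6 * k) / k = j / k + 6 := Nat.add_mul_div_right j 6 (by omega)
  have h2 := Nat.div_le_self j k
  rw [h1]
  have : 6 ≤ 6 * k := by omega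
  omega

/-- Turns, multiples. [folklore] -/
theorem footIdx_add_mul_period {k : ℕ} (hk : 1 ≤ k) (j n : ℕ) :
    footIdx k (j + n * (6 * k)) = footIdx k j + n * (6 * (k - 1)) := by
  induction n with
  | zero => simp
  | succ n ih =>
    rw [Nat.add_mul, Nat.one_mul, ← Nat.add_assoc, footIdx_add_period hk, ih]
    ring

/-- The foot index in side–position form: `footIdx k (c k + t) = c (k-1) + t` for `t < k`. [folklore] -/
theorem footIdx_eq {k c t : ℕ} (hk : 1 ≤ k) (ht : t < k) : footIdx k (c * k + t) = c * (k - 1) + t := by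
  unfold footIdx
  have h1 : (c * k + t) / k = c := by
    rw [Nat.add_comm, Nat.add_mul_div_right t c (by omega), Nat.div_eq_of_lt ht, Nat.zero_add]
  rw [h1]
  have : c * k = c * (k - 1) + c := by
    have := Nat.succ_pred_eq_of_pos (by omega : 0 < k)
    conv_lhs => rw [← Nat.sub_add_cancel hk]
    rw [Nat.mul_add, Nat.mul_one]
  omega

/-! ### The feet are adjacent -/

/-- **The upper foot**: `rp k j ∼ rp (k-1) (footIdx k j)` (`k ≥ 2`). [folklore] -/
theorem rp_adj_rp_footIdx {k : ℕ} (hk : 2 ≤ k) (j : ℕ) : triGraph.Adj (rp k j) (rp (k - 1) (footIdx k j)) := by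
  -- side `c < 6` and position `t < k` of `j`, and its number of turns `a`
  set Q := j / k with hQ
  set t := j % k with ht
  set a := Q / 6 with ha
  set c := Q % 6 with hc
  have hk1 : 1 ≤ k := by omega
  have htk : t < k := Nat.mod_lt _ (by omega)
  have hc6 : c < 6 := Nat.mod_lt _ (by norm_num)
  have hj : j = k * Q + t := (Nat.div_add_mod j k).symm
  have hQ6 : Q = 6 * a + c := (Nat.div_add_mod Q 6).symm
  have hj' : j = (c * k + t) + a * (6 * k) := by rw [hj, hQ6]; ring
  have hlt : c * k + t < 6 * k := by nlinarith
  -- the rim site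
  have e1 : rp k j = ringPt k (c * k + t) := by rw [hj', rp_add_mul_period, rp_of_lt hlt]
  -- the foot
  have e2 : footIdx k j = (c * (k - 1) + t) + a * (6 * (k - 1)) := by
    rw [hj', footIdx_add_mul_period hk1, footIdx_eq hk1 htk]
  have e3 : rp (k - 1) (footIdx k j) = ringPt (k - 1) (c * (k - 1) + t) := by
    rw [e2, rp_add_mul_period]
    by_cases h : c * (k - 1) + t < 6 * (k - 1)
    · rw [rp_of_lt h]
    · -- the last site before a full turn: `c = 5`, `t = k - 1`
      have hct : c * (k - 1) + t = 6 * (k - 1) := by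
        have : c * (k - 1) ≤ 5 * (k - 1) := Nat.mul_le_mul_right _ (by omega)
        omega
      rw [hct, rp, Nat.mod_self, ← ringPt_six_mul]
  rw [e1, e3]
  exact ringPt_adj_ringPt_pred_hi hk hc6 htk

/-- At a corner the lower and the upper foot coincide: `footIdx k (j - 1) = footIdx k j` when `k ∣ j`, `j ≥ 1`. [folklore] -/
theorem footIdx_pred_eq_of_dvd {k j : ℕ} (hj : 1 ≤ j) (h : k ∣ j) : footIdx k (j - 1) = footIdx k j := by
  have := (footIdx_succ_eq_iff (k := k) (j := j - 1)).2 (by rwa [Nat.sub_add_cancel hj])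
  rw [Nat.sub_add_cancel hj] at this
  exact this.symm

/-- **The lower foot**: `rp k j ∼ rp (k-1) (footIdx k (j-1))` (`k ≥ 2`, `j ≥ 1`). [folklore] -/
theorem rp_adj_rp_footIdx_pred {k : ℕ} (hk : 2 ≤ k) {j : ℕ} (hj1 : 1 ≤ j) :
    triGraph.Adj (rp k j) (rp (k - 1) (footIdx k (j - 1))) := by
  have hk1 : 1 ≤ k := by omega
  by_cases hdvd : k ∣ j
  · rw [footIdx_pred_eq_of_dvd hj1 hdvd]; exact rp_adj_rp_footIdx hk j
  -- off the corners: `t ≥ 1` and the foot is `c (k-1) + t - 1`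
  set Q := j / k with hQ
  set t := j % k with ht
  set a := Q / 6 with ha
  set c := Q % 6 with hc
  have htk : t < k := Nat.mod_lt _ (by omega)
  have ht1 : 1 ≤ t := by
    rw [Nat.one_le_iff_ne_zero]; intro h0
    exact hdvd (Nat.dvd_of_mod_eq_zero (by rw [← ht, h0]))
  have hc6 : c < 6 := Nat.mod_lt _ (by norm_num)
  have hj : j = k * Q + t := (Nat.div_add_mod j k).symm
  have hQ6 : Q = 6 * a + c := (Nat.div_add_mod Q 6).symm
  have hj' : j = (c * k + t) + a * (6 * k) := by rw [hj, hQ6]; ring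
  have hlt : c * k + t < 6 * k := by nlinarith
  have e1 : rp k j = ringPt k (c * k + t) := by rw [hj', rp_add_mul_period, rp_of_lt hlt]
  have hjm : j - 1 = (c * k + (t - 1)) + a * (6 * k) := by omega
  have e2 : footIdx k (j - 1) = (c * (k - 1) + t - 1) + a * (6 * (k - 1)) := by
    rw [hjm, footIdx_add_mul_period hk1, footIdx_eq hk1 (by omega)]; omega
  have hlt' : c * (k - 1) + t - 1 < 6 * (k - 1) := by
    have : c * (k - 1) ≤ 5 * (k - 1) := Nat.mul_le_mul_right _ (by omega)
    omega
  have e3 : rp (k - 1) (footIdx k (j - 1)) = ringPt (k - 1) (c * (k - 1) + t - 1) := by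
    rw [e2, rp_add_mul_period, rp_of_lt hlt']
  rw [e1, e3]
  exact ringPt_adj_ringPt_pred_lo hk hc6 ht1 htk

/-- **The feet of a ring site are its two foot indices** (read upwards): the site of index `j ≥ 1`
on `∂Λ_k` is adjacent to `rp (k-1) f` for `f = footIdx k (j-1)` and for `f = footIdx k j`, and
`footIdx k (j - 1) ≤ footIdx k j ≤ footIdx k (j-1) + 1`. [folklore] -/
theorem footIdx_pred_le {k j : ℕ} (hj : 1 ≤ j) : footIdx k (j - 1) ≤ footIdx k j ∧ footIdx k j ≤ footIdx k (j - 1) + 1 := by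
  have h1 := footIdx_mono k (Nat.sub_le j 1)
  have h2 := footIdx_succ_le k (j - 1)
  rw [Nat.sub_add_cancel hj] at h2
  exact ⟨h1, h2⟩

/-! ### Runs along a ring -/

/-- **A run of consecutive ring sites is a lattice path** inside any set containing its sites. [folklore] -/
theorem pathIn_rp_run {k : ℕ} (hk : 1 ≤ k) {S : Set (Site 2)} {a b : ℕ} (hab : a ≤ b)
    (hS : ∀ j, a ≤ j → j ≤ b → rp k j ∈ S) : PathIn triGraph S (rp k a) (rp k b) :=
  FourArmFlip.pathIn_of_seq (rp k) (s := a) (T := b + 1) (fun j _ _ => Or.inr (rp_adj hk j))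
    (fun j hj hjT => hS j hj (by omega)) b hab (by omega)

/-- A run of consecutive ring sites, traversed backwards. [folklore] -/
theorem pathIn_rp_run' {k : ℕ} (hk : 1 ≤ k) {S : Set (Site 2)} {a b : ℕ} (hab : a ≤ b)
    (hS : ∀ j, a ≤ j → j ≤ b → rp k j ∈ S) : PathIn triGraph S (rp k b) (rp k a) :=
  (pathIn_rp_run hk hab hS).symm

/-- Two steps advance the foot index (`k ≥ 2`). [folklore] -/
theorem footIdx_add_two {k : ℕ} (hk : 2 ≤ k) (j : ℕ) : footIdx k j + 1 ≤ footIdx k (j + 2) := by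
  have := footIdx_add_ge (j := j) (d := 2) (by omega) hk
  omega

end Literature.Probability.Percolation
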